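import Mathlib
import HarnessLib
import Literature.Analysis.FluidPDE.TypeIAncientMild
import Literature.Analysis.FluidPDE.NSWeakProductRule
import Summits.NavierStokesRegularity.NavierStokesRegularity.Theorems.PoloidalWindowDoorPoloidalWindowRigidityPoloidalExtremal
import Summits.NavierStokesRegularity.NavierStokesRegularity.Theorems.PoloidalWindowDoorPoloidalWindowRigiditySymmetryGerms

/-!
# Route `PoloidalWindowDoor`, crux `PoloidalWindowRigidity` (stmt-NavierStokesRegularity-19708) — LINE 24 «least_pin» v1.0
# (ns-idea-8 g11, `Cruxes/PoloidalWindowRigidity/Lines/least_pin.lean` 98e095f0b5f9): support stub U3a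
# `stub_anisotropicGap : AnisotropicGap`, VERBATIM (the Cruxes-local `AnisotropicGap` unfolded)

Seat ns-es-p1 g8 (free prover hand on ⟨19708⟩; CLAIM announced on the ideators bus before proposing).

* `anisotropicGap` — **THE ANISOTROPIC GAP: the small-constant gap read along the poloidal axis.**  For every Type-I constant `C` there
  is `δ = δ(C) > 0` such that every e₂-poloidal element `v` of the Type-I ancient mild class `A_C`
  (`Literature.Analysis.FluidPDE.IsTypeIAncientMild C v`, `⟪curl v(s), e₂⟫ ≡ 0`) whose VERTICAL component is scale-covariantly small,
  `√(−t)|v₂(t,x)| ≤ δ`, vanishes identically.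

PROOF (template: the extraction of the tree's `…PoloidalExtremal.exists_poloidal_extremal`, p469616).  If not, there are poloidal `vₖ ∈ A_C`,
`vₖ ≢ 0`, with `√(−t)|vₖ,₂| ≤ 1/(k+1)`; by the ISOTROPIC gap (`Theorems.exists_typeIAncientMild_eq_zero_of_small`: an element of `A_ε`
vanishes) `vₖ ∉ A_ε`, so there are `(tₖ, xₖ)` with `√(−tₖ)‖vₖ(tₖ, xₖ)‖ > ε`.  The renormalised fields
`wₖ := nsRescale √(−tₖ) (vₖ(·, xₖ + ·))` are in `A_C` (`isTypeIAncientMild_nsRescale ∘ isTypeIAncientMild_translate`), e₂-poloidal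
(`poloidal_nsRescale ∘ poloidal_translate`), have `‖wₖ(−1, 0)‖ > ε` and — the bound being SCALE-INVARIANT — `√(−s)|wₖ,₂(s,y)| ≤ 1/(k+1)`.
A KNSS limit with gradients (`Theorems.exists_tendsto_of_isTypeIAncientMild_seq`) `W ∈ A_C` is poloidal (`poloidal_of_tendsto`), has
`‖W(−1, 0)‖ ≥ ε` and `W₂ ≡ 0` on the slab; hence `∂₀W₂(−1, ·) ≡ 0`, and the tree's vertical rigidity
`…SymmetryGerms.eq_zero_of_horizontalGradient_eq_zero_on_open` (horizontal gradient of `v₂` vanishing on an open set at one poloidal time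
forces `v ≡ 0`) kills `W` — contradiction.

HONEST LABEL: ONE support stub (M) of a files-only line (critic verdict pending at typing time; fired only after PASS); it closes no cell, no
crux and no route item; U3b, the research cell `CellLeastPin`, ⟨19708⟩ / ⟨20428⟩ and NS regularity stay OPEN — no summit statement is
proved here.
-/

noncomputable section

-- the summit and its single sub-problem share the name (CONVENTIONS §1), as in every Theorems file
set_option linter.dupNamespace false

namespace Summit.NavierStokesRegularity.NavierStokesRegularity.Theorems.PoloidalWindowDoorPoloidalWindowRigidityLeastPinAnisotropicGap

open Set Function Filter Topology
open scoped RealInnerProductSpace InnerProductSpace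
open Literature.Analysis Literature.Analysis.FluidPDE
open Summit.NavierStokesRegularity.NavierStokesRegularity.Theorems
open Summit.NavierStokesRegularity.NavierStokesRegularity.Theorems.PoloidalWindowDoorPoloidalWindowRigidityPoloidalExtremal

/-! ## Vertical rigidity at one time -/

/-- **Vertical rigidity** (two lines from the tree's `…SymmetryGerms.eq_zero_of_horizontalGradient_eq_zero_on_open`): an e₂-poloidal-at-time-`s`
element of `A_C` whose vertical component vanishes identically at that time is `≡ 0` on the whole past. -/
theorem eq_zero_of_coordTwo_eq_zero {C : ℝ} {W : ℝ → EuclideanSpace ℝ (Fin 3) → EuclideanSpace ℝ (Fin 3)} (hW : IsTypeIAncientMild C W)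
    {s : ℝ} (hs : s < 0) (hpol : ∀ y, ⟪curl (W s) y, EuclideanSpace.single 2 1⟫_ℝ = 0) (h2 : ∀ y, W s y 2 = 0) :
    ∀ t < 0, ∀ x, W t x = 0 := by
  have hD : ∀ y ∈ (Set.univ : Set (EuclideanSpace ℝ (Fin 3))), fderiv ℝ (W s) y (EuclideanSpace.single 0 1) 2 = 0 := by
    intro y _
    have hdiff : DifferentiableAt ℝ (W s) y := ((hW.contDiff_slice hs).differentiable (by simp)) y
    rw [← fderiv_coord_apply hdiff 2 (EuclideanSpace.single 0 1)]
    have hz : (fun y => W s y 2) = fun _ => (0 : ℝ) := funext fun y => h2 y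
    rw [hz]
    simp
  exact PoloidalWindowDoorPoloidalWindowRigiditySymmetryGerms.eq_zero_of_horizontalGradient_eq_zero_on_open hW.hasTypeITimeDecay
    hW.continuousOn_uncurry (fun s t hst ht x => hW.mild_eq_heatExtension hst ht x) (fun t ht => hW.isDivFree ht) hs hpol
    isOpen_univ Set.univ_nonempty hD

/-! ## The stub -/

/-- **U3a `AnisotropicGap` (VERBATIM, the Cruxes-local def unfolded): the anisotropic gap** — for every `C` there is `δ > 0` such that every
e₂-poloidal class-`C` profile with `sup √(−t)|v₂| ≤ δ` is `≡ 0` (module docstring for the proof). -/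
theorem anisotropicGap :
    ∀ C : ℝ, ∃ δ : ℝ, 0 < δ ∧ ∀ v : ℝ → EuclideanSpace ℝ (Fin 3) → EuclideanSpace ℝ (Fin 3), IsTypeIAncientMild C v →
      (∀ s < 0, ∀ y, ⟪curl (v s) y, EuclideanSpace.single 2 1⟫_ℝ = 0) →
      (∀ t < 0, ∀ x, Real.sqrt (-t) * |v t x 2| ≤ δ) → ∀ t < 0, ∀ x, v t x = 0 := by
  intro C
  by_contra hcon
  push Not at hcon
  -- the isotropic gap: an element of `A_ε` vanishes
  obtain ⟨ε, hε, hsmall⟩ := exists_typeIAncientMild_eq_zero_of_small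
  -- violators `v k`: poloidal, class `C`, vertically `1/(k+1)`-small, with an isotropic-gap point `(t k, x k)`
  have hch : ∀ k : ℕ, ∃ v : ℝ → EuclideanSpace ℝ (Fin 3) → EuclideanSpace ℝ (Fin 3), IsTypeIAncientMild C v ∧
      (∀ s < 0, ∀ y, ⟪curl (v s) y, EuclideanSpace.single 2 1⟫_ℝ = 0) ∧
      (∀ t < 0, ∀ x, Real.sqrt (-t) * |v t x 2| ≤ 1 / ((k : ℝ) + 1)) ∧
      ∃ t < 0, ∃ x : EuclideanSpace ℝ (Fin 3), ε < Real.sqrt (-t) * ‖v t x‖ := by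
    intro k
    obtain ⟨v, hv, hpol, hδ, t₀, ht₀, x₀, hx₀⟩ := hcon (1 / ((k : ℝ) + 1)) (by positivity)
    refine ⟨v, hv, hpol, hδ, ?_⟩
    by_contra h
    push Not at h
    have hvε : IsTypeIAncientMild ε v := by
      refine ⟨hv.1, hv.2.1, hv.2.2.1, fun t ht x => ?_⟩
      rw [le_div_iff₀ (Real.sqrt_pos.2 (neg_pos.2 ht)), mul_comm]
      exact h t ht x
    exact hx₀ (hsmall ε v hvε le_rfl t₀ ht₀ x₀)
  choose vk hvk hvkpol hvk2 tk htk xk hxk using hch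
  -- renormalisation to the point `(−1, 0)`
  set wk : ℕ → ℝ → EuclideanSpace ℝ (Fin 3) → EuclideanSpace ℝ (Fin 3) := fun k =>
    nsRescale (Real.sqrt (-tk k)) (fun t x => vk k t (xk k + x)) with hwk_def
  have hck : ∀ k, 0 < Real.sqrt (-tk k) := fun k => Real.sqrt_pos.2 (neg_pos.2 (htk k))
  have hwk : ∀ k, IsTypeIAncientMild C (wk k) := fun k =>
    isTypeIAncientMild_nsRescale (isTypeIAncientMild_translate (hvk k) (xk k)) (hck k)
  have hwkpol : ∀ k, ∀ s < 0, ∀ y, ⟪curl (wk k s) y, EuclideanSpace.single 2 (1 : ℝ)⟫_ℝ = 0 := fun k =>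
    poloidal_nsRescale (poloidal_translate (hvkpol k) (xk k)) (hck k)
  have hw_apply : ∀ k s y, wk k s y =
      Real.sqrt (-tk k) • vk k (Real.sqrt (-tk k) ^ 2 * s) (xk k + Real.sqrt (-tk k) • y) := fun k s y => by
    simp [hwk_def, nsRescale_apply]
  -- nontrivial at `(−1, 0)`
  have hlow : ∀ k, ε < ‖wk k (-1) 0‖ := fun k => by
    rw [hw_apply, smul_zero, add_zero, mul_neg_one, Real.sq_sqrt (neg_nonneg.2 (htk k).le), neg_neg, norm_smul,
      Real.norm_of_nonneg (Real.sqrt_nonneg _)]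
    exact hxk k
  -- the vertical smallness is scale-invariant
  have hwk2 : ∀ k, ∀ s < 0, ∀ y, Real.sqrt (-s) * |wk k s y 2| ≤ 1 / ((k : ℝ) + 1) := by
    intro k s hs y
    set c : ℝ := Real.sqrt (-tk k) with hc
    have hc0 : 0 < c := hck k
    have hs' : c ^ 2 * s < 0 := mul_neg_of_pos_of_neg (pow_pos hc0 2) hs
    have h := hvk2 k (c ^ 2 * s) hs' (xk k + c • y)
    have hsq : Real.sqrt (-(c ^ 2 * s)) = c * Real.sqrt (-s) := by
      rw [show -(c ^ 2 * s) = c ^ 2 * (-s) by ring, Real.sqrt_mul' _ (neg_nonneg.2 hs.le), Real.sqrt_sq hc0.le]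
    rw [hsq] at h
    rw [hw_apply, ← hc, PiLp.smul_apply, smul_eq_mul, abs_mul, abs_of_pos hc0]
    calc Real.sqrt (-s) * (c * |vk k (c ^ 2 * s) (xk k + c • y) 2|)
        = c * Real.sqrt (-s) * |vk k (c ^ 2 * s) (xk k + c • y) 2| := by ring
      _ ≤ 1 / ((k : ℝ) + 1) := h
  -- KNSS compactness, fields AND gradients
  obtain ⟨φ, hφ, W, hW, hpt, hDpt, -, -⟩ := exists_tendsto_of_isTypeIAncientMild_seq C hwk
  have hWpol : ∀ s < 0, ∀ y, ⟪curl (W s) y, EuclideanSpace.single 2 (1 : ℝ)⟫_ℝ = 0 := fun s hs y =>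
    poloidal_of_tendsto (hDpt s hs y) fun j => hwkpol (φ j) s hs y
  -- `‖W(−1, 0)‖ ≥ ε`
  have hW1 : ε ≤ ‖W (-1) 0‖ :=
    ge_of_tendsto ((hpt (-1) (by norm_num) 0).norm) (Eventually.of_forall fun j => (hlow (φ j)).le)
  -- `W₂ ≡ 0` on the slab
  have hW2 : ∀ s < 0, ∀ y, W s y 2 = 0 := by
    intro s hs y
    have hss : 0 < Real.sqrt (-s) := Real.sqrt_pos.2 (neg_pos.2 hs)
    have hcoord : Tendsto (fun j => wk (φ j) s y 2) atTop (𝓝 (W s y 2)) :=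
      ((EuclideanSpace.proj (2 : Fin 3) : EuclideanSpace ℝ (Fin 3) →L[ℝ] ℝ).continuous.tendsto _).comp (hpt s hs y)
    have habs : Tendsto (fun j => |wk (φ j) s y 2|) atTop (𝓝 |W s y 2|) := hcoord.abs
    have hrhs : Tendsto (fun j : ℕ => (1 / ((j : ℝ) + 1)) / Real.sqrt (-s)) atTop (𝓝 0) := by
      have h := (tendsto_one_div_add_atTop_nhds_zero_nat).div_const (Real.sqrt (-s))
      rwa [zero_div] at h
    have hle : ∀ j, |wk (φ j) s y 2| ≤ (1 / ((j : ℝ) + 1)) / Real.sqrt (-s) := by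
      intro j
      rw [le_div_iff₀ hss, mul_comm]
      refine (hwk2 (φ j) s hs y).trans ?_
      have hj : (j : ℝ) ≤ (φ j : ℝ) := by exact_mod_cast hφ.id_le j
      gcongr
    have h0 : |W s y 2| ≤ 0 := le_of_tendsto_of_tendsto' habs hrhs hle
    exact abs_nonpos_iff.1 h0
  -- vertical rigidity at the poloidal time `−1`: `W₂(−1, ·) ≡ 0` forces `W ≡ 0`
  have hneg1 : (-1 : ℝ) < 0 := by norm_num
  have hzero : ∀ t < 0, ∀ x, W t x = 0 := eq_zero_of_coordTwo_eq_zero hW hneg1 (hWpol (-1) hneg1) (hW2 (-1) hneg1)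
  -- contradiction at `(−1, 0)`
  have h0 : W (-1) 0 = 0 := hzero (-1) hneg1 0
  rw [h0, norm_zero] at hW1
  exact absurd hW1 (not_le.2 hε)

end Summit.NavierStokesRegularity.NavierStokesRegularity.Theorems.PoloidalWindowDoorPoloidalWindowRigidityLeastPinAnisotropicGap

end
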